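/-
Copyright (c) 2026 the pub-hodgecm-mathlib formalisation cell (harness21).  Prover seat hodgecm-mathlib-K2Liu-p25 (g2), Track B «K2-LIT» ∕ hLiu418
#184♮ = `stmt-HodgeConjecture-24832`, socket #41 — ORGAN (T) glue: #41 AT A STANDARD DATUM FROM #41 AT ANY `H(𝔸)`-CONJUGATE DATUM (LEAD F0P6-plan (g14) RULING «M-158j»
road (R-c), BATCH #70 (1)).  THEOREMS ONLY (no `def`, no instance, no notation, no `sorry`).
-/
import Summits.HodgeConjecture.HodgeConjecture.Theorems.K2LiuSiegelEisensteinRightTranslation   -- ★ (T) `isStandardSectionFamily_normalisedTranslate`, `continuation_transport`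
import HarnessLib

/-!
# Crux `HLiu418`, socket #41, ORGAN (T) glue: SOCKET #41's CONCLUSION AT `𝒦` FROM SOCKET #41 AT ANY CONJUGATE DATUM `𝒦₀` (`𝒦.K = c 𝒦₀.K c⁻¹`, ANY `c ∈ H(𝔸)`)

Cell `hodgecm-mathlib`, crux item hLiu418 = `stmt-HodgeConjecture-24832`; squad K2 ∕ K2Liu (L1, LEAD F0P6-plan (g14)); prover K2Liu-p25 (g2).  THEOREMS ONLY; lane
`--supports stmt-HodgeConjecture-24832 --as helper`.

ONE DECL FOR THE TOP WRITER.  ★ (T) `K2LiuSiegelEisensteinRightTranslation` transports socket #41's five clauses along the NORMALISED translate by `p ∈ P_Δ(𝔸)`; the S2 organ's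
★ `K2LiuStdConjDatumFrameCompact.exists_conjDatum_frameCompact` (and ★ `K2LiuArchSWRegionSpanningTransport.exists_iwasawaDatum_conj`) hand conjugate data in the shape
`∀ k, k ∈ 𝒦₀.K ↔ c k c⁻¹ ∈ 𝒦.K` with `c ∈ H(𝔸)` ARBITRARY (archimedean in practice).  THIS FILE closes the gap `H(𝔸)`-conjugate ⇒ `P_Δ(𝔸)`-conjugate: by the Iwasawa
decomposition OF `𝒦₀`, `c = p k₀` with `k₀ ∈ 𝒦₀.K`, so `c 𝒦₀.K c⁻¹ = p 𝒦₀.K p⁻¹` (`k₀` normalises `𝒦₀.K`) — `siegelDelta_conj_of_conj`; hence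
**`continuation_of_conjDatum`**: if socket #41's conclusion holds for EVERY standard continuous family of `𝒦₀`, it holds for every standard continuous family of `𝒦`
(★ (T) §3 at `p⁻¹` + ★ (T) §4).  With ★ §5 `K2LiuIwasawaDatumConjStd.isStd_of_conj` (the conjugate of a standard datum is standard) this is the (R-c) transport in ONE line:
`#41 ∀ std families on the class 𝒞` + `every std 𝒦 is H(𝔸)-conjugate to some 𝒦₀ ∈ 𝒞` ⇒ `#41 ∀ std 𝒦`.
References: [MoeglinWaldspurger1995, II.1.5, IV.1.8]; [BorelJacquet1979, §1.2, §4.1]; [Tan1999, §1].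
HONEST LABEL.  Count-neutral helper: `HC_CM` is proved only modulo the 7 printed citations (2 remaining named inputs: hLiu418 = `stmt-HodgeConjecture-24832`,
h413 = `stmt-HodgeConjecture-24833`) until rung 0 closes; this file closes no socket (the class `𝒞` on which #41 is proved is the I-lineage's).
-/

set_option autoImplicit false
set_option linter.dupNamespace false -- the mandated namespace repeats `HodgeConjecture.HodgeConjecture`

noncomputable section

open scoped Matrix Topology
open NumberField IsDedekindDomain Filter Set Metric
open Literature.NumberTheory.Automorphic Literature.NumberTheory.GaloisRepresentations
open Literature.NumberTheory.GelbartRogawski1991 Literature.NumberTheory.GelbartRogawski1991.GRConstruction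
open Literature.NumberTheory.K2Lit.SiegelDoubled

namespace Summit.HodgeConjecture.HodgeConjecture.Cruxes.HLiu418.K2LiuSiegelEisensteinConjugateDatumTransport

open Summit.HodgeConjecture.HodgeConjecture.Cruxes.HLiu418.K2LiuSiegelEisensteinRightTranslation
  (isStandardSectionFamily_normalisedTranslate continuous_normalisedTranslate continuation_transport)

variable (L : Type) [Field L] [NumberField L] [IsCMField L]
variable {N M n : ℕ} (e : Fin N × Fin M ≃ Fin n)
  (dV : Fin N → L) (hdV : ∀ i, IsCMField.complexConj L (dV i) = dV i)
  (dW : Fin M → L) (hdW : ∀ i, IsCMField.complexConj L (dW i) = dW i)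

/-- **`H(𝔸)`-CONJUGATE ⇒ `P_Δ(𝔸)`-CONJUGATE**: if `𝒦₀.K = c⁻¹ 𝒦.K c` (membership `k ∈ 𝒦₀.K ↔ c k c⁻¹ ∈ 𝒦.K`) for some `c ∈ H(𝔸)`, then there is `p ∈ P_Δ(𝔸)` with
`p 𝒦₀.K p⁻¹ ⊆ 𝒦.K` — write `c = p k₀` by the Iwasawa decomposition of `𝒦₀`; `k₀` normalises `𝒦₀.K`.  Stated with `q := p⁻¹` in ★ (T) §3's `hKK'` shape
`∀ k ∈ 𝒦₀.K, q⁻¹ k q ∈ 𝒦.K`. [cite: BorelJacquet1979, §4.1] [cite: MoeglinWaldspurger1995, I.2.1] -/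
theorem siegelDelta_conj_of_conj (𝒦₀ 𝒦 : IwasawaDatum L e dV hdV dW hdW) (c : HA L e dV hdV dW hdW)
    (hc : ∀ k : HA L e dV hdV dW hdW, k ∈ 𝒦₀.K ↔ c * k * c⁻¹ ∈ 𝒦.K) :
    ∃ q : HA L e dV hdV dW hdW, IsSiegelDelta L e dV hdV dW hdW q ∧ ∀ k : HA L e dV hdV dW hdW, k ∈ 𝒦₀.K → q⁻¹ * k * q ∈ 𝒦.K := by
  obtain ⟨p, k₀, hp, hk₀, hck⟩ := 𝒦₀.iwasawa c
  refine ⟨p⁻¹, isSiegelDelta_inv L e dV hdV dW hdW hp, fun k hk => ?_⟩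
  have hmem : k₀⁻¹ * k * k₀ ∈ 𝒦₀.K := 𝒦₀.K.mul_mem (𝒦₀.K.mul_mem (𝒦₀.K.inv_mem hk₀) hk) hk₀
  have h := (hc _).1 hmem
  have hEq : c * (k₀⁻¹ * k * k₀) * c⁻¹ = p⁻¹⁻¹ * k * p⁻¹ := by rw [hck]; group
  rwa [hEq] at h

/-- **SOCKET #41 AT `𝒦` FROM SOCKET #41 AT ANY CONJUGATE DATUM `𝒦₀`.**  `𝒦₀, 𝒦` Iwasawa data with `k ∈ 𝒦₀.K ↔ c k c⁻¹ ∈ 𝒦.K` for some `c ∈ H(𝔸)` (★ S2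
`exists_conjDatum_frameCompact` (i) ∕ ★ `exists_iwasawaDatum_conj` shape); if socket #41's conclusion `∃ P Es, (A1) ∧ … ∧ (A5)` holds for EVERY standard continuous family of
`(𝒦₀, χ)`, then it holds for every standard continuous family `f′` of `(𝒦, χ)`: apply the hypothesis to the normalised translate of `f′` along `q = p⁻¹ ∈ P_Δ(𝔸)`
(`siegelDelta_conj_of_conj`, ★ (T) `isStandardSectionFamily_normalisedTranslate`) and transport back (★ (T) `continuation_transport`).
[cite: MoeglinWaldspurger1995, II.1.5, IV.1.8] [cite: BorelJacquet1979, §1.2, §4.1] [cite: Tan1999, §1] -/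
theorem continuation_of_conjDatum (hn : 0 < n) {χ : HeckeCharacter L} (𝒦₀ 𝒦 : IwasawaDatum L e dV hdV dW hdW) (c : HA L e dV hdV dW hdW)
    (hc : ∀ k : HA L e dV hdV dW hdW, k ∈ 𝒦₀.K ↔ c * k * c⁻¹ ∈ 𝒦.K)
    (h41 : ∀ f : ℂ → HA L e dV hdV dW hdW → ℂ, IsStandardSectionFamily 𝒦₀ χ f → (∀ s, Continuous (f s)) →
      ∃ (P : Finset ℂ) (Es : ℂ → HA L e dV hdV dW hdW → ℂ),
        (∀ h : HA L e dV hdV dW hdW, DifferentiableOn ℂ (fun s => Es s h) {s : ℂ | 0 < s.re}) ∧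
        (∀ s : ℂ, 0 < s.re → Continuous (Es s)) ∧
        (∀ s : ℂ, 0 < s.re → ∀ (γ : ratH L e dV hdV dW hdW) (h : HA L e dV hdV dW hdW), Es s ((γ : HA L e dV hdV dW hdW) * h) = Es s h) ∧
        (∀ (s : ℂ) (h : HA L e dV hdV dW hdW), (n : ℝ) / 2 < s.re →
          Es s h = (∏ q ∈ P, (s - q)) * eisensteinFamilyDelta L e dV hdV dW hdW f s h) ∧
        (∀ z : ℂ, 0 < z.re → ∃ C A r : ℝ, 0 < r ∧ ∀ s : ℂ, dist s z < r → ∀ h : HA L e dV hdV dW hdW,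
          ‖Es s h‖ ≤ C * adelicHeightGL (n + n) L (h : GL (Fin (n + n)) (AdeleRing (𝓞 L) L)) ^ A))
    (f' : ℂ → HA L e dV hdV dW hdW → ℂ) (hstd' : IsStandardSectionFamily 𝒦 χ f') (hcont' : ∀ s, Continuous (f' s)) :
    ∃ (P : Finset ℂ) (Es : ℂ → HA L e dV hdV dW hdW → ℂ),
      (∀ h : HA L e dV hdV dW hdW, DifferentiableOn ℂ (fun s => Es s h) {s : ℂ | 0 < s.re}) ∧
      (∀ s : ℂ, 0 < s.re → Continuous (Es s)) ∧
      (∀ s : ℂ, 0 < s.re → ∀ (γ : ratH L e dV hdV dW hdW) (h : HA L e dV hdV dW hdW), Es s ((γ : HA L e dV hdV dW hdW) * h) = Es s h) ∧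
      (∀ (s : ℂ) (h : HA L e dV hdV dW hdW), (n : ℝ) / 2 < s.re →
        Es s h = (∏ q ∈ P, (s - q)) * eisensteinFamilyDelta L e dV hdV dW hdW f' s h) ∧
      (∀ z : ℂ, 0 < z.re → ∃ C A r : ℝ, 0 < r ∧ ∀ s : ℂ, dist s z < r → ∀ h : HA L e dV hdV dW hdW,
        ‖Es s h‖ ≤ C * adelicHeightGL (n + n) L (h : GL (Fin (n + n)) (AdeleRing (𝓞 L) L)) ^ A) := by
  obtain ⟨q, hq, hKK'⟩ := siegelDelta_conj_of_conj L e dV hdV dW hdW 𝒦₀ 𝒦 c hc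
  obtain ⟨P, Es, hA1, hA2, hA3, hA4, hA5⟩ := h41 _ (isStandardSectionFamily_normalisedTranslate 𝒦₀ 𝒦 hq hKK' hstd')
    (continuous_normalisedTranslate hcont' (fun s => siegelDeltaCharacter L e dV hdV dW hdW χ s q) q)
  exact continuation_transport L e dV hdV dW hdW hn q f' P Es hA1 hA2 hA3 hA4 hA5

end Summit.HodgeConjecture.HodgeConjecture.Cruxes.HLiu418.K2LiuSiegelEisensteinConjugateDatumTransport

end
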